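import Summits.CriticalPhenomena.PercolationContinuityZ3.Theorems.Transplant.SkelPhiNegReachFinalK
import Summits.CriticalPhenomena.PercolationContinuityZ3.Theorems.Transplant.SkelPhiNegReachGlueA
import Summits.CriticalPhenomena.PercolationContinuityZ3.Theorems.Transplant.SkelPhiNegReachHolds
import Summits.CriticalPhenomena.PercolationContinuityZ3.Theorems.Transplant.SkelNegBParamsReachTA
import Summits.CriticalPhenomena.PercolationContinuityZ3.Theorems.Transplant.SkelNegBParamsSlotsSUA
import Summits.CriticalPhenomena.PercolationContinuityZ3.Theorems.Transplant.SkelNegBParamsColA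
import Summits.CriticalPhenomena.PercolationContinuityZ3.Theorems.Transplant.SkelNegBParamsLOA
import Summits.CriticalPhenomena.PercolationContinuityZ3.Theorems.Transplant.SkelNegBParamsResidualsA
import HarnessLib

/-!
# N1 (the `{±1}` node), (C) column under (ζ′) — (C-A8-K): **THE (C) RESIDUE OF THE (ζ′) CHOICE FUNCTION `negChoiceAllOTA`** —
# `PlanarSkeletonNeg.NegB.reachOblRHN_negBTA_SU/_at`: for the slots `gv := KS.gT mk gx`, `fv := KS.fT mk fx`, `Pv := KS.PR mk Px`, `Sv := NegB.SUA ex mx`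
# (stmt-g16's (ζ′) chain: fine map `fineOA` at `A := Aof κ = 20·K`, cells `fcellsA`, schedule `schedOfA (SUA …)`, arrival boxes `b0TA = r/4 = 10·Kq` strides,
# NEG-SCOPE §B.19 (ζ′); slot-ledger ζ′ v1) and ANY residual functions `gx fx Px mx`, the corridor residue `Skel.ReachOblRHN G (926·Kq) (scheme O q) (FD O q)
# Φ.Δ (κ.δr 0)` at `(O, q)` — corridor length `926·Kq` (≤ `NegB.LfA κ.K₀ = 2000·Kq`), kits at the FLAT ROOT ACCURACY `κ.δr 0` (the closure of record
# `…_of_choiceFnNOWL`) — as soon as the residual depth slot `ex` clears the two floors `r₀A(R_l) + 3 ≤ ex` and `4 + 13·(20K·(n_L + W_B)) ≤ ex`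
# (`20K = 800·Kq`: the habitat points of a band of `800·Kq` strides). EVERYTHING ELSE IS DISCHARGED: the corridor residue is
# `Skelφ.reachOblRHN_negSG₂b_of_floorsK` (C-S11-K, box multiplier `kq := Kq`) read through `NegB.choiceAtOTA_reach_iff`; its primitive floors are the
# record's `KS.nL_floorsT` (P1) / `KS.corridor_floors_T` (P2) (kq-free) and stmt-g16's `NegB.aWTA_le` (P3-K) / `NegB.U_bLTA_le` (P4-K) /
# `NegB.r_le_four_b0TA` (P5), the frame change `NegB.ha_TA/hBx_TA/hb_TA`, the commensurability `NegB.hsc_RA` (`K = 40·Kq`), `40·Kq ≤ r_i` (`fcellsA_K`);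
# the (ζ′) fine map / cells / schedule / columns (`fineOA`, `fcellsA`, `schedOfA (SUA …)`, `offNA`, `colVA`), the apron kit of record (cell-free: `KS.apron`,
# counts `KS.counts_R` at `κ.δr 0` via `Neg.δkit_le_δr`), the kit pair's region and exit table, the zone family, the Step-I″ inputs (through
# `atQOB/atQOS_of_atQOTA`), and the excess (`NegB.hRex_UA` with `fine_diam_le_mRA`, `hsch_UA`, `ex_le_Lp_UA`, `three_le_E₀_UA`, `hgap20_UA/hgapc_UA/hgapL_UA`).
# * §1 `NegB.reachOblRHN_negBTA_SU` — any box/width/pair slots, from (P1), (P2), the layer inequality, `24 ≤ ℓ_L`, the zone clearance, the kit pair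
#   listed, and the two `ex` floors; * §2 `NegB.reachOblRHN_negBTA_at` — at `(gT, fT, PR)`: only the two `ex` floors remain;
# * §3 **`reachHoldsRHNOFnL_negChoiceAllOTA (mk gx fx Px ex mx) (hex)`** — `ReachHoldsRHNOFnL NegB.LfA` of the (ζ′) choice function, GENERAL in every slot,
#   the two `ex`-floors as a hypothesis (the record's `reachHoldsRHNOFn_negChoiceAllOT` shape with `800 ↦ 20K`); **`…_exA (gx fx Px mx)`** — kit index `0`,
#   `ex := NegB.exA`, NO HYPOTHESES (floors = stmt-g16's `NegB.hex_exA`): THE (C) HYPOTHESIS OF `samePDropOfSkeletonNeg₁_of_choiceFnNOWL` AT THE TUPLE OF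
#   RECORD (ADOPTION IN FORCE (L), lead 2026-08-22T04:19Z; slot-ledger ζ′ v1: `gv := KS.gT 0 (KS.gxA c)`, `fv := KS.fT 0 KS.fxA`, any `Px`, `Sv := SUA exA mx`);
#   **`…_R (c Px mx)`** — the same at the ledger's `gx := KS.gxA c`, `fx := KS.fxA`.
# Refuter self-check (p5 lineage): every floor of the (ζ′) corridor is homogeneous of degree one in `Kq` on both sides — no `Kq`-multiple is compared against
# a cell budget; the S1 corridor design (rooms `5r/22r/2r`, target `20r`, `b₀ = r/4`) is untouched.

builds on p205010 (kernel theorem, internal audit signed; external expert review pending) — nothing in this file uses p205010; NOTHING is claimed about the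
open node `SamePDropOfSkeletonNeg₁`: this is its (C) hypothesis for the (ζ′) choice function — modulo two floors on the slot `ex` (§1–§2), unconditional at `ex := exA` (§3).
Lane `prim-bschramm`, seat `prim-bschramm-p5` (gen 11; (C) lineage); helper file (`--supports stmt-CriticalPhenomena-4575 --as helper`); slot-ledger ζ′ v1.
[cite: KozmaNitzan2024, §4 Theorem 6 (pp. 25–31), Lemma 10 Steps III–V (pp. 19–22), Lemma 11 (pp. 22–23), Lemma 12 (pp. 23–25)] [cite: MartineauTassion2017, §3.2, §4.3 Lemma 4.2]
-/

noncomputable section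

open scoped Classical

namespace Summit.CriticalPhenomena.PercolationContinuityZ3.Theorems.Transplant

open MeasureTheory Literature.Probability.Percolation Literature.Probability.LatticeModels SimpleGraph KNCells KNLevels
open Literature.Barriers.CriticalPhenomena (graphBall mem_graphBall_self graphBall_mono)
open BoxProdZ2 (ConcRadiiG Erad)

namespace PlanarSkeletonNeg

open SkelConc (Consts)
open Skelφ (oriφ trφ runX RgO pexXO shearUnit pgramPrismFin pgSideHalfW pgTopPieceW)
open Skelφ.StepI (DataN OutO eventNAt)
open SkelI (tanOff)

namespace NegB

open Neg

section AtQ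

variable {κ : Consts} {V : Type} [DecidableEq V] [Countable V] {G : SimpleGraph V} [G.LocallyFinite] {Φ : PlanarSkeletonNeg G} {t : V} {p : unitInterval}
  {hC : Φ.CylSubcritical p} {gv fv : Neg.FSlot} {Pv : PSlot} {ex mx : GSlot} {O : OutO V} {q : unitInterval}

/-! ## §1 The residue at one `(O, q)`, any box / width / pair slots -/

set_option maxHeartbeats 800000 in
/-- **THE (C) RESIDUE OF THE CHOICES OF RECORD AT `(O, q)`** (fibre block `SU ex mx`, any `gv fv Pv`): `Skel.ReachOblRHN` of the scheme of record from the
primitive floors that read the slots — (P1) `2000(RA′+2) ≤ n_L`, (P2) `2000(RA′+2)·U_L ≤ n_Lℓ_L − n_L`, the layer inequality `2U_L ≤ n_Lℓ_L + 1`, `24 ≤ ℓ_L`,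
the zone clearance `(M_u+4)U_L ≤ n_L(ℓ_L+1)`, the kit pair listed — and the two floors on `ex`; the slot reads are NAMED (`hg : gOf … = g`, `hf : fOf … = f`)
so that every floor is stated at plain `(g, f)`. [cite: KozmaNitzan2024, §4 Lemmas 10–12 (pp. 17–25), p. 30 (Step IV)] -/
theorem reachOblRHN_negBTA_SU (hAt : (choiceAtOTA κ Φ t p gv fv (SUA ex mx) hC Pv).AtQO O q) (h1 : Φ.types = {t}) (hp0 : 0 < (p : ℝ)) (hp1 : (p : ℝ) < 1)
    (mk : ℕ) (hPk : (KS.MK O.merged mk, KS.nKit O.merged mk) ∈ (Pv κ Φ t p O.merged).1)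
    {g f : ℕ} (hg : gOf κ Φ t p O gv = g) (hf : fOf κ Φ t p O fv = f)
    (P1 : 2000 * (KS.RA' κ Φ t p O.merged mk + 2) ≤ nL κ Φ t p O.merged g f)
    (P2 : 2000 * ((KS.RA' κ Φ t p O.merged mk : ℤ) + 2) * (shearUnit (nL κ Φ t p O.merged g f) (hL κ Φ t p O.merged g f) : ℤ) ≤ (nL κ Φ t p O.merged g f : ℤ) * ℓL κ Φ t p O.merged g f - nL κ Φ t p O.merged g f)
    (hlay : 2 * ((nL κ Φ t p O.merged g f + ((hL κ Φ t p O.merged g f)).natAbs : ℕ) : ℤ) ≤ (nL κ Φ t p O.merged g f : ℤ) * ℓL κ Φ t p O.merged g f + 1) (hℓ24 : 24 ≤ ℓL κ Φ t p O.merged g f)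
    (hclear : (Mu O.merged + 4) * (nL κ Φ t p O.merged g f + ((hL κ Φ t p O.merged g f)).natAbs) ≤ nL κ Φ t p O.merged g f * (ℓL κ Φ t p O.merged g f + 1))
    (hex₁ : KS.r₀A Φ t O.merged mk (O.merged.R (O.merged.scale t (ML κ Φ t p O.merged g) (nL κ Φ t p O.merged g f))) + 3 ≤ ex κ Φ t p O.merged g f)
    (hex₂ : 4 + 13 * (20 * Neg.K κ * (nL κ Φ t p O.merged g f + Skelφ.CorrRec.Qw (nL κ Φ t p O.merged g f) (ℓL κ Φ t p O.merged g f) (hL κ Φ t p O.merged g f))) ≤ ex κ Φ t p O.merged g f) :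
    Skel.ReachOblRHN G (926 * Neg.Kq κ) ((choiceAtOTA κ Φ t p gv fv (SUA ex mx) hC Pv).scheme O q) ((choiceAtOTA κ Φ t p gv fv (SUA ex mx) hC Pv).FD O q) Φ.Δ (κ.δr 0) := by
  rw [choiceAtOTA_reach_iff]
  obtain ⟨hF, hq1, hq2, hCq⟩ := factsO_of_atQOTA hAt
  have hAtS := atQOS_of_atQOTA hAt
  have hAtB := atQOB_of_atQOTA hAt
  obtain ⟨hm₀k, hk1, hkM₀, hReq, hΛeq⟩ := hF.seed
  have hEqL := clauseL_of_atQOTA hAt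
  have hNL := eqNumL_of_atQOTA hAt
  obtain ⟨hnSK, hκSK, hℓSK⟩ := KS.pexXO_facts_of_atQOS (g := g) (f := f) mk hAtS
  have hInL := fun c fam σ τ => inputsLAt_of_atQOB hAtB h1 c fam σ τ
  -- name the slot reads (`g = gOf …`, `f = fOf …`) everywhere, then the derived long data
  rw [hg, hf] at hEqL hNL hInL ⊢
  set vβ : ℤ := Skelφ.NegPrm.vβOf (nL κ Φ t p O.merged g f) (hL κ Φ t p O.merged g f) (ℓL κ Φ t p O.merged g f) (vL κ Φ t p O.merged g f) with hvβ
  set Dof : ℤ := Skelφ.NegPrm.DofA (Aof κ) (nL κ Φ t p O.merged g f) (hL κ Φ t p O.merged g f) (ℓL κ Φ t p O.merged g f) (vL κ Φ t p O.merged g f) with hDof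
  set Rl : ℕ := O.merged.R (O.merged.scale t (ML κ Φ t p O.merged g) (nL κ Φ t p O.merged g f)) with hRl
  obtain ⟨hnL, hℓL⟩ := one_le_of_eqNumL κ Φ t p O.merged g f hNL
  have hκL : ((hL κ Φ t p O.merged g f)).natAbs ≤ 10 * (nL κ Φ t p O.merged g f) := hEqL.2
  have hκL10 : |(hL κ Φ t p O.merged g f)| ≤ 10 * (((nL κ Φ t p O.merged g f) : ℕ) : ℤ) := by rw [← Int.natCast_natAbs]; exact_mod_cast hκL
  have hvn : |(vL κ Φ t p O.merged g f)| ≤ ((nL κ Φ t p O.merged g f) : ℤ) := hNL.v_le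
  have hlip : Skelφ.Lip G (φL κ Φ t p O.D O.DT O.ori g f) := lip_φL κ Φ t p O.D O.DT O.ori g f
  have hstep : Skelφ.Steps G (φL κ Φ t p O.D O.DT O.ori g f) := steps_φL κ Φ t p O.D O.DT O.ori g f
  have hfr : Skelφ.Frames G (φL κ Φ t p O.D O.DT O.ori g f) Φ.types := Skelφ.frames_oriφ Φ.frame _
  have hκc : Skelφ.CylConn G (φL κ Φ t p O.D O.DT O.ori g f) Φ.types := Skelφ.cylConn_oriφ Φ.cyl_connected _
  have hAf : 0 < Aof κ := (Aof_pos κ).1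
  have hm : 0 < TwoAxis.Para.modulus (nL κ Φ t p O.merged g f) (hL κ Φ t p O.merged g f) (vL κ Φ t p O.merged g f) vβ := Skelφ.NegPrm.modulus_vβOf_pos hnL hℓL _ _
  obtain ⟨hΔlo, hΔhi⟩ := Skelφ.NegPrm.modulus_vβOf hnL (hL κ Φ t p O.merged g f) (ℓL κ Φ t p O.merged g f) (vL κ Φ t p O.merged g f)
  have hK1 : (0 : ℤ) < ((fcellsA κ Φ t p O.merged g f).K : ℤ) := by rw [(fcellsA_K κ Φ t p O.merged g f).1]; exact_mod_cast (Neg.forty_le_K κ).2.2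
  have hc0' : (0 : ℤ) < 20 * ((fcellsA κ Φ t p O.merged g f).K : ℤ) * (((fcellsA κ Φ t p O.merged g f).s 0 : ℕ) : ℤ) :=
    mul_pos (mul_pos (by norm_num) hK1) (by exact_mod_cast (fcellsA κ Φ t p O.merged g f).hs 0)
  have hc1' : (0 : ℤ) < 20 * ((fcellsA κ Φ t p O.merged g f).K : ℤ) * (((fcellsA κ Φ t p O.merged g f).s 1 : ℕ) : ℤ) :=
    mul_pos (mul_pos (by norm_num) hK1) (by exact_mod_cast (fcellsA κ Φ t p O.merged g f).hs 1)
  have hDf : 0 < Dof := Skelφ.NegPrm.DofA_pos (Aof_pos κ).2 hnL hℓL _ _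
  have hkq : 1 ≤ Neg.Kq κ := Neg.one_le_Kq κ
  have hr40 : ∀ i, 40 * (Neg.Kq κ : ℤ) ≤ ((fcellsA κ Φ t p O.merged g f).r i : ℤ) := fun i => by
    rw [(fcellsA_K κ Φ t p O.merged g f).2.2 i, Neg.K_eq]
    have hs : 1 ≤ (fcellsA κ Φ t p O.merged g f).s i := (fcellsA κ Φ t p O.merged g f).hs i
    have : 40 * Neg.Kq κ * 1 ≤ 40 * Neg.Kq κ * (fcellsA κ Φ t p O.merged g f).s i := Nat.mul_le_mul_left _ hs
    exact_mod_cast (by omega : 40 * Neg.Kq κ ≤ 40 * Neg.Kq κ * (fcellsA κ Φ t p O.merged g f).s i)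
  -- ### the fine map of record
  have hfine : fineOA κ Φ t p O.D O.DT O.ori g f =
      Skelφ.fineSkel (φL κ Φ t p O.D O.DT O.ori g f) t (Aof κ) (nL κ Φ t p O.merged g f) (hL κ Φ t p O.merged g f) (vL κ Φ t p O.merged g f) vβ (20 * ((fcellsA κ Φ t p O.merged g f).K : ℤ) * (((fcellsA κ Φ t p O.merged g f).s 0 : ℕ) : ℤ)) (20 * ((fcellsA κ Φ t p O.merged g f).K : ℤ) * (((fcellsA κ Φ t p O.merged g f).s 1 : ℕ) : ℤ)) (Dof / 2) (Dof / 2) Dof := rfl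
  have hlipF : Skelφ.Lip G (fineOA κ Φ t p O.D O.DT O.ori g f) := lip_fineA_at κ Φ t p O.merged g f hlip hNL
  have hwsF : Skelφ.WeakSteps G (fineOA κ Φ t p O.D O.DT O.ori g f) := weakSteps_fineA_at κ Φ t p O.merged g f hstep hNL
  have hF0 : fineOA κ Φ t p O.D O.DT O.ori g f t = 0 := fineA_base_at κ Φ t p O.merged g f (φL κ Φ t p O.D O.DT O.ori g f) hNL
  have eβ : vβL κ Φ t p O.merged g f = vβ := rfl
  have hsc0 : 20 * ((fcellsA κ Φ t p O.merged g f).K : ℤ) * (((fcellsA κ Φ t p O.merged g f).s 0 : ℕ) : ℤ) * Aof κ * (40 * (Neg.Kq κ : ℤ) * TwoAxis.Para.modulus (nL κ Φ t p O.merged g f) (hL κ Φ t p O.merged g f) (vL κ Φ t p O.merged g f) vβ) = ((fcellsA κ Φ t p O.merged g f).r 0 : ℤ) * Dof := by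
    have h := hsc_RA κ Φ t p O.merged g f 0
    rw [eβ, Neg.K_eq] at h; push_cast at h; linear_combination h
  have hsc1 : 20 * ((fcellsA κ Φ t p O.merged g f).K : ℤ) * (((fcellsA κ Φ t p O.merged g f).s 1 : ℕ) : ℤ) * Aof κ * (40 * (Neg.Kq κ : ℤ) * TwoAxis.Para.modulus (nL κ Φ t p O.merged g f) (hL κ Φ t p O.merged g f) (vL κ Φ t p O.merged g f) vβ) = ((fcellsA κ Φ t p O.merged g f).r 1 : ℤ) * Dof := by
    have h := hsc_RA κ Φ t p O.merged g f 1
    rw [eβ, Neg.K_eq] at h; push_cast at h; linear_combination h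
  -- ### the schedule of record and its columns
  have hΛ : Skelφ.WFS2 (fcellsA κ Φ t p O.merged g f) (schedOfA κ Φ t p O.merged g f (SUA ex mx κ Φ t p O.merged g f q)) := schedOfA_WFS2 κ Φ t p O.merged g f _
  have hgap : ∀ m, 20 * (fcellsA κ Φ t p O.merged g f).rmax ≤ Skelφ.Prm.gap (SUA ex mx κ Φ t p O.merged g f q) m := hgap20_UA κ Φ t p O.merged g f ex mx q
  have hgapc : ∀ m, cOffA κ Φ t p O.merged g f ≤ Skelφ.Prm.gap (SUA ex mx κ Φ t p O.merged g f q) m := hgapc_UA κ Φ t p O.merged g f ex mx q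
  have hoff : ∀ x : Site 2, offNA κ Φ t p O.merged g f x ≤ cOffA κ Φ t p O.merged g f * ((x 0).natAbs + (x 1).natAbs) + 1 :=
    offNA_le κ Φ t p O.merged g f hNL hκL
  have hE₀ : 3 ≤ Skelφ.Prm.E₀ (SUA ex mx κ Φ t p O.merged g f q) := (three_le_E₀_UA κ Φ t p O.merged g f ex mx q).1
  have hgapL : ∀ ρ, Skelφ.Prm.Lp (SUA ex mx κ Φ t p O.merged g f q) ≤ Skelφ.Prm.gap (SUA ex mx κ Φ t p O.merged g f q) ρ := hgapL_UA κ Φ t p O.merged g f ex mx q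
  obtain ⟨hexL, hLE⟩ := ex_le_Lp_UA κ Φ t p O.merged g f ex mx q
  have hcol : ∀ a x, ∃ y ∈ Skelφ.VWin G (fineOA κ Φ t p O.D O.DT O.ori g f) t ((fcellsA κ Φ t p O.merged g f).Q x) ((schedOfA κ Φ t p O.merged g f (SUA ex mx κ Φ t p O.merged g f q)).rQ a x),
      fineOA κ Φ t p O.D O.DT O.ori g f y = (fcellsA κ Φ t p O.merged g f).cen x := fun a x =>
    ⟨colVA κ Φ t p O.merged g f hlip hstep hNL x, colVA_mem_VWin_schedOfA κ Φ t p O.merged g f hlip hstep hNL _ a x, colVA_eq κ Φ t p O.merged g f hlip hstep hNL x⟩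
  have hcF : ∀ (a : ℕ) (y : Site 2), fineOA κ Φ t p O.D O.DT O.ori g f (colVA κ Φ t p O.merged g f hlip hstep hNL y) = (fcellsA κ Φ t p O.merged g f).cen y := fun _ y =>
    colVA_eq κ Φ t p O.merged g f hlip hstep hNL y
  have hcQ : ∀ (a : ℕ) (y : Site 2), colVA κ Φ t p O.merged g f hlip hstep hNL y ∈
      Skelφ.VWin G (fineOA κ Φ t p O.D O.DT O.ori g f) t ((fcellsA κ Φ t p O.merged g f).Q y) ((schedOfA κ Φ t p O.merged g f (SUA ex mx κ Φ t p O.merged g f q)).rQ a y) := fun a y =>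
    colVA_mem_VWin_schedOfA κ Φ t p O.merged g f hlip hstep hNL _ a y
  have hcD : ∀ (a : ℕ) (y : Site 2), colVA κ Φ t p O.merged g f hlip hstep hNL y ∈
      graphBall G t (cOffA κ Φ t p O.merged g f * ((y 0).natAbs + (y 1).natAbs) + 1) := fun _ y =>
    colVA_mem_graphBall κ Φ t p O.merged g f hlip hstep hNL hκL y
  -- ### the frame change and the five primitive floors
  have ha := ha_TA κ Φ t p O.merged g f hNL
  have hBx := hBx_TA κ Φ t p O.merged g f hNL
  have hb' := hb_TA κ Φ t p O.merged g f
  obtain ⟨-, -, hbL1⟩ := aWTA_nonneg κ Φ t p O.merged g f hNL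
  have P3 : ((Skelφ.CorrRec.WA (nL κ Φ t p O.merged g f) (aWTA κ Φ t p O.merged g f) : ℕ) : ℤ) ≤ 24 * (Neg.Kq κ : ℤ) * ((nL κ Φ t p O.merged g f) : ℤ) := by
    have h := aWTA_le κ Φ t p O.merged g f hNL
    have h' : (aWTA κ Φ t p O.merged g f).toNat ≤ 24 * Neg.Kq κ * (nL κ Φ t p O.merged g f) := Int.toNat_le.2 (by push_cast; exact h)
    have h0 : nL κ Φ t p O.merged g f ≤ 24 * Neg.Kq κ * (nL κ Φ t p O.merged g f) := Nat.le_mul_of_pos_left _ (by omega)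
    have h'' : Skelφ.CorrRec.WA (nL κ Φ t p O.merged g f) (aWTA κ Φ t p O.merged g f) ≤ 24 * Neg.Kq κ * (nL κ Φ t p O.merged g f) := by
      unfold Skelφ.CorrRec.WA; exact max_le h0 h'
    exact_mod_cast h''
  have P4 : (shearUnit (nL κ Φ t p O.merged g f) (hL κ Φ t p O.merged g f) : ℤ) * (((Skelφ.CorrRec.L0A (bLTA κ Φ t p O.merged g f) : ℕ) : ℤ) + 1) ≤ 12 * (Neg.Kq κ : ℤ) * TwoAxis.Para.modulus (nL κ Φ t p O.merged g f) (hL κ Φ t p O.merged g f) (vL κ Φ t p O.merged g f) vβ := by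
    have h := U_bLTA_le κ Φ t p O.merged g f hNL hκL hℓ24
    have e : ((Skelφ.CorrRec.L0A (bLTA κ Φ t p O.merged g f) : ℕ) : ℤ) = bLTA κ Φ t p O.merged g f := by
      unfold Skelφ.CorrRec.L0A; exact Int.toNat_of_nonneg (by linarith)
    rw [e]; exact h
  have P5 : ∀ i, (fcellsA κ Φ t p O.merged g f).r i ≤ 4 * b0TA κ Φ t p O.merged g f i := fun i => (r_le_four_b0TA κ Φ t p O.merged g f i).1
  have hbr : ∀ i, ((b0TA κ Φ t p O.merged g f i : ℕ) : ℤ) ≤ 2 * ((fcellsA κ Φ t p O.merged g f).r i : ℤ) := fun i => by exact_mod_cast (r_le_four_b0TA κ Φ t p O.merged g f i).2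
  have hKq8 : 20 * Neg.K κ = 800 * Neg.Kq κ := by rw [Neg.K_eq]; ring
  have hex₂' : 4 + 13 * (800 * Neg.Kq κ * ((nL κ Φ t p O.merged g f) + Skelφ.CorrRec.Qw (nL κ Φ t p O.merged g f) (ℓL κ Φ t p O.merged g f) (hL κ Φ t p O.merged g f))) ≤ ex κ Φ t p O.merged g f := by
    rw [← hKq8]; exact hex₂
  have hE₀Z : 1 + (10 + 3) * (800 * Neg.Kq κ * ((nL κ Φ t p O.merged g f) + Skelφ.CorrRec.Qw (nL κ Φ t p O.merged g f) (ℓL κ Φ t p O.merged g f) (hL κ Φ t p O.merged g f))) + 3 ≤ Skelφ.Prm.E₀ (SUA ex mx κ Φ t p O.merged g f q) := by omega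
  -- ### levels and the apron kit of record (runX frame: `A := (M_u+1)·U_L + 1`, `r₀ := r₀A(Rl)`)
  have hRA := KS.RA'_eq κ Φ t p O.merged mk
  have hRl : KS.RlevA κ Φ t p O.merged mk + 1 ≤ KS.RA' κ Φ t p O.merged mk := hRA.2.1.le
  have hj : KS.j₁A κ Φ t p O.merged mk ≤ KS.RlevA κ Φ t p O.merged mk := hRA.2.2
  let Pk : Skelφ.ApronPrm := KS.apron Φ t O.merged mk ((Mu O.merged + 1 : ℕ) * (shearUnit (nL κ Φ t p O.merged g f) (hL κ Φ t p O.merged g f) : ℤ) + 1) (KS.r₀A Φ t O.merged mk Rl)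
  obtain ⟨hPN, hd1, hD1, hD2, hDρ, hℓk, hWk, hKmax, hKCmax, hR', hT, hT'⟩ :=
    KS.apron_ok Φ t O.merged mk ((Mu O.merged + 1 : ℕ) * (shearUnit (nL κ Φ t p O.merged g f) (hL κ Φ t p O.merged g f) : ℤ) + 1) (KS.r₀A Φ t O.merged mk Rl) (c := 10 + 1) (by norm_num)
  obtain ⟨hrs, hcS⟩ := KS.apron_sizes Φ t O.merged mk ((Mu O.merged + 1 : ℕ) * (shearUnit (nL κ Φ t p O.merged g f) (hL κ Φ t p O.merged g f) : ℤ) + 1) (KS.r₀A Φ t O.merged mk Rl)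
  have hr₀ := KS.hr₀_apron Φ t O.merged mk ((Mu O.merged + 1 : ℕ) * (shearUnit (nL κ Φ t p O.merged g f) (hL κ Φ t p O.merged g f) : ℤ) + 1) (KS.r₀A_ge Φ t O.merged mk Rl).1
  have hRlreach := KS.hreach_apron Φ t O.merged mk ((Mu O.merged + 1 : ℕ) * (shearUnit (nL κ Φ t p O.merged g f) (hL κ Φ t p O.merged g f) : ℤ) + 1) (KS.r₀A_ge Φ t O.merged mk Rl).2
  have hR'k : Skelφ.cylRadMax G (φL κ Φ t p O.D O.DT O.ori g f) Φ.types Pk.ℓ (KS.Rs t O.merged mk + KS.KCmax t O.merged mk + (Pk.W + KS.Kmax t O.merged mk)) ≤ Pk.R' := by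
    unfold NegB.φL; rw [Skelφ.cylRadMax_oriφ]; exact hR'
  have hj₀T := KS.j₀A_ge Φ t O.merged mk ((Mu O.merged + 1 : ℕ) * (shearUnit (nL κ Φ t p O.merged g f) (hL κ Φ t p O.merged g f) : ℤ) + 1) (KS.r₀A Φ t O.merged mk Rl)
  have hjreach := rootKit_reach κ Φ t p O.merged mk ((Mu O.merged + 1 : ℕ) * (shearUnit (nL κ Φ t p O.merged g f) (hL κ Φ t p O.merged g f) : ℤ) + 1) (KS.r₀A Φ t O.merged mk Rl)
  have hr₀L : Pk.r₀ + 3 ≤ Skelφ.Prm.Lp (SUA ex mx κ Φ t p O.merged g f q) := le_trans hex₁ hexL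
  -- counts at the flat root accuracy `κ.δr 0`
  have hδk : Neg.δkit κ Φ ≤ κ.δr 0 := Neg.δkit_le_δr κ Φ (n := 0) (by norm_num)
  obtain ⟨hk, hcount⟩ := KS.counts_R κ Φ t p O.merged mk hp0 hp1 hq1 hq2 hδk
  have hkN := KS.hNk_at κ Φ t p O.merged mk hp0 hp1
  have hδ0 : 0 < κ.δr 0 := (κ.hδr 0).1
  have hδI : Neg.δI κ Φ ≤ κ.δr 0 ^ 2 := Neg.δI_le_sq_of_le κ Φ hδk
  have hη : Neg.η κ Φ ≤ κ.δr 0 / 2 := by linarith [(Neg.η_pos κ Φ).2.1, hδk]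
  -- ### the kit pair's region and exit table
  have hQKf := fun c => KS.QKO_facts κ Φ t p O.D O.DT O.ori g f mk c
  have hRgRs : ∀ c, (KS.QKO κ Φ t p O.D O.DT O.ori g f mk).RS c ≤ KS.Rs t O.merged mk := fun c => by rw [(hQKf c).2.2.2.1]; exact (KS.RK_le_Rs t O.merged mk).1
  have hRg : ∀ c, ∀ u ∈ RgO G (φL κ Φ t p O.D O.DT O.ori g f) (KS.QKO κ Φ t p O.D O.DT O.ori g f mk) c, u ∈ graphBall G c (KS.Rs t O.merged mk) := fun c u hu =>
    graphBall_mono G c (hRgRs c) (Skelφ.RgO_subset_graphBall (KS.QKO κ Φ t p O.D O.DT O.ori g f mk) c u hu)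
  have hRgcard : ∀ c, (RgO G (φL κ Φ t p O.D O.DT O.ori g f) (KS.QKO κ Φ t p O.D O.DT O.ori g f mk) c).card ≤ KS.cUA Φ t O.merged mk := fun c => by
    rw [KS.RgO_QKO]; exact KS.card_RgK_le Φ t O.merged mk _ c
  have hcU1 := KS.hcU1_at Φ t O.merged mk
  have hQ : ∀ c, (KS.QKO κ Φ t p O.D O.DT O.ori g f mk).nS c = KS.nKit O.merged mk ∧ (KS.QKO κ Φ t p O.D O.DT O.ori g f mk).hS c = O.merged.hgt t (KS.MK O.merged mk) (KS.nKit O.merged mk) ∧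
      (KS.QKO κ Φ t p O.D O.DT O.ori g f mk).ℓS c = O.merged.len t (KS.MK O.merged mk) (KS.nKit O.merged mk) ∧
      (KS.QKO κ Φ t p O.D O.DT O.ori g f mk).RS c = O.merged.R (O.merged.scale t (KS.MK O.merged mk) (KS.nKit O.merged mk)) ∧
      (KS.QKO κ Φ t p O.D O.DT O.ori g f mk).vS c = O.merged.spl t (KS.MK O.merged mk) (KS.nKit O.merged mk) := fun c => ⟨rfl, rfl, rfl, rfl, rfl⟩
  have hPex : ∀ (cb : V) (Lo Hi : Site 2) (i : Fin 2) (σ₀ : ℤˣ) (c : V), ∀ v ∈ pexXO G (φL κ Φ t p O.D O.DT O.ori g f) (KS.QKO κ Φ t p O.D O.DT O.ori g f mk) (Mu O.merged) (nL κ Φ t p O.merged g f) (hL κ Φ t p O.merged g f) Pk.A 1 i σ₀ c,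
      v ∈ RgO G (φL κ Φ t p O.D O.DT O.ori g f) (KS.QKO κ Φ t p O.D O.DT O.ori g f mk) c ∧
      (Skelφ.runXSideU (φ := (φL κ Φ t p O.D O.DT O.ori g f)) cb hnL (hL κ Φ t p O.merged g f) (Or.inl rfl) Lo Hi i σ₀).lin ((φL κ Φ t p O.D O.DT O.ori g f) v) + Pk.A +
        ((Skelφ.runXSideU (φ := (φL κ Φ t p O.D O.DT O.ori g f)) cb hnL (hL κ Φ t p O.merged g f) (Or.inl rfl) Lo Hi i σ₀).s : ℤ) *
          Skelφ.coef (Skelφ.runXSideU (φ := (φL κ Φ t p O.D O.DT O.ori g f)) cb hnL (hL κ Φ t p O.merged g f) (Or.inl rfl) Lo Hi i σ₀).cα (Skelφ.runXSideU (φ := (φL κ Φ t p O.D O.DT O.ori g f)) cb hnL (hL κ Φ t p O.merged g f) (Or.inl rfl) Lo Hi i σ₀).cβ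
            (Skelφ.runXSideU (φ := (φL κ Φ t p O.D O.DT O.ori g f)) cb hnL (hL κ Φ t p O.merged g f) (Or.inl rfl) Lo Hi i σ₀).a ≤
      (Skelφ.runXSideU (φ := (φL κ Φ t p O.D O.DT O.ori g f)) cb hnL (hL κ Φ t p O.merged g f) (Or.inl rfl) Lo Hi i σ₀).lin ((φL κ Φ t p O.D O.DT O.ori g f) c) := fun cb Lo Hi i σ₀ c =>
    Skelφ.pexXO_spec cb hnL (hL κ Φ t p O.merged g f) (Or.inl rfl) hκL10 Lo Hi (KS.QKO κ Φ t p O.D O.DT O.ori g f mk) rfl hnSK hκSK hℓSK i σ₀ c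
  -- ### the zone family
  have hkM : O.merged.k ≤ Mu O.merged := hkM₀
  have hkn : ∀ c, O.merged.Λ c O.merged.k ⊆ O.merged.Λ c (Mu O.merged) := fun c => by
    rw [hΛeq]; exact Skelφ.fatSeq_monotone Φ.frame hC c hkM
  have hZφ : ∀ c, (↑(O.merged.Λ c (Mu O.merged)) : Set V) ⊆ Skelφ.cyl Φ.φ c (Mu O.merged) := fun c => by
    rw [hΛeq]; exact Skelφ.fatSeq_subset_cyl Φ.frame hC c _
  have hZc : ∀ c, (↑(O.merged.Λ c (Mu O.merged)) : Set V) ⊆ Skelφ.cyl (φL κ Φ t p O.D O.DT O.ori g f) c (Mu O.merged) := fun c => by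
    unfold NegB.φL; rw [Skelφ.cyl_oriφ]; exact hZφ c
  have hΛRg := KS.hΛRg_of_atQOS mk hAtS
  have hΛz : ∀ c, ∀ v ∈ O.merged.Λ c (Mu O.merged), v ∈ RgO G (φL κ Φ t p O.D O.DT O.ori g f) (KS.QKO κ Φ t p O.D O.DT O.ori g f mk) c ∧ (φL κ Φ t p O.D O.DT O.ori g f) v - (φL κ Φ t p O.D O.DT O.ori g f) c ∈ box 2 (Mu O.merged) := fun c v hv => by
    refine ⟨?_, ?_⟩
    · rw [KS.RgO_QKO]; exact hΛRg c hv
    · exact (Skelφ.mem_cyl (φ := (φL κ Φ t p O.D O.DT O.ori g f)) c (Mu O.merged) v).1 (hZc c (Finset.mem_coe.2 hv))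
  have hMz : Mu O.merged < (nL κ Φ t p O.merged g f) := lt_of_le_of_lt (Mu_le_ML κ Φ t p O.merged g) (ML_lt_nL κ Φ t p O.merged g f).1
  -- ### the Step-I″ inputs at every centre
  have hzone : ∀ c, 1 - κ.δr 0 ^ 2 < (bondPercolation G q).real (UniqZone.zone G (O.merged.Λ c) O.merged.k (Mu O.merged)) :=
    fun c => lt_of_le_of_lt (by linarith [hδI]) (zoneAt_of_atQOB hAtB h1 c)
  have hservedK : ∀ (c : V) (fam : Fin 2) (σ' τ' : ℤˣ), 1 - κ.δr 0 ^ 2 < (bondPercolation G q).real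
      (linkIn (Skelφ.StepI.regionNAt G (oriφ (φL κ Φ t p O.D O.DT O.ori g f) ((KS.QKO κ Φ t p O.D O.DT O.ori g f mk).oS c)) O.merged t c (KS.MK O.merged mk) (KS.nKit O.merged mk))
        (O.merged.Λ c O.merged.k) (Skelφ.StepI.pieceNAt G (oriφ (φL κ Φ t p O.D O.DT O.ori g f) ((KS.QKO κ Φ t p O.D O.DT O.ori g f mk).oS c)) O.merged t c (KS.MK O.merged mk) (KS.nKit O.merged mk) fam σ' τ')) := by
    intro c fam σ' τ'
    have h := inputsExtraAt_of_atQOB hAtB h1 c hPk fam σ' τ'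
    rw [Skelφ.StepI.eventNAt_some] at h
    have hmap : oriφ (φL κ Φ t p O.D O.DT O.ori g f) ((KS.QKO κ Φ t p O.D O.DT O.ori g f mk).oS c) = oriφ Φ.φ (O.ori t (KS.MK O.merged mk) (KS.nKit O.merged mk)) := by
      rw [(hQKf c).2.2.2.2.2, KS.oriφ_φL_oS]; rfl
    rw [hmap]
    exact lt_of_le_of_lt (by linarith [hδI]) h
  have hexit := Skelφ.real_pexXO_gt (φ := (φL κ Φ t p O.D O.DT O.ori g f)) (Λ := O.merged.Λ) (k := O.merged.k) hQ hservedK (Mu O.merged) (nL κ Φ t p O.merged g f) (hL κ Φ t p O.merged g f) Pk.A (Or.inl rfl : (1 : ℤ) = 1 ∨ (1 : ℤ) = -1)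
  have hlongT : ∀ c (σ τ : ℤ), σ = 1 ∨ σ = -1 → τ = 1 ∨ τ = -1 → 1 - κ.δr 0 ^ 2 < (bondPercolation G q).real
      (linkIn (Skelφ.pgramPrism G (φL κ Φ t p O.D O.DT O.ori g f) c (nL κ Φ t p O.merged g f) (hL κ Φ t p O.merged g f) (3 * (ℓL κ Φ t p O.merged g f)) Rl) (O.merged.Λ c O.merged.k) (pgTopPieceW G (φL κ Φ t p O.D O.DT O.ori g f) c (nL κ Φ t p O.merged g f) (hL κ Φ t p O.merged g f) (ℓL κ Φ t p O.merged g f) Rl σ τ (vL κ Φ t p O.merged g f))) := by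
    intro c σ τ hσ hτ
    have h := hInL c 1 (Skelφ.sgnU σ) (Skelφ.sgnU τ)
    rw [Skelφ.StepI.eventNAt_some] at h
    unfold Skelφ.StepI.regionNAt Skelφ.StepI.pieceNAt at h
    rw [if_neg (by decide), Skelφ.val_sgnU hσ, Skelφ.val_sgnU hτ] at h
    exact lt_of_le_of_lt (by linarith [hδI]) h
  have hlongS : ∀ c (σ τ : ℤ), σ = 1 ∨ σ = -1 → τ = 1 ∨ τ = -1 → 1 - κ.δr 0 ^ 2 < (bondPercolation G q).real
      (linkIn (Skelφ.pgramPrism G (φL κ Φ t p O.D O.DT O.ori g f) c (nL κ Φ t p O.merged g f) (hL κ Φ t p O.merged g f) (3 * (ℓL κ Φ t p O.merged g f)) Rl) (O.merged.Λ c O.merged.k) (pgSideHalfW G (φL κ Φ t p O.D O.DT O.ori g f) c (nL κ Φ t p O.merged g f) (hL κ Φ t p O.merged g f) (ℓL κ Φ t p O.merged g f) Rl σ (σ * τ))) := by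
    intro c σ τ hσ hτ
    have hστ : σ * τ = 1 ∨ σ * τ = -1 := by rcases hσ with h | h <;> rcases hτ with h' | h' <;> simp [h, h']
    have h := hInL c 0 (Skelφ.sgnU σ) (Skelφ.sgnU (σ * τ))
    rw [Skelφ.StepI.eventNAt_some] at h
    unfold Skelφ.StepI.regionNAt Skelφ.StepI.pieceNAt at h
    rw [if_pos rfl, Skelφ.val_sgnU hσ, Skelφ.val_sgnU hστ] at h
    exact lt_of_le_of_lt (by linarith [hδI]) h
  -- ### the excess at the value (fine diameter `50·rmax` ⇒ planar diameter `mR`)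
  have hRex : ∀ R₀' R₁, Rex κ Φ (mRA κ Φ t p O.merged g f (mx κ Φ t p O.merged g f)) q R₀' ≤ R₁ → ∀ (Rw : ℕ) (D' A' : Finset V),
      (∀ d ∈ D', d ∈ graphBall G t Rw) → (∀ d ∈ D', ∀ d' ∈ D', fineOA κ Φ t p O.D O.DT O.ori g f d - fineOA κ Φ t p O.D O.DT O.ori g f d' ∈ box 2 (50 * (fcellsA κ Φ t p O.merged g f).rmax)) →
        A' ⊆ D' → (∀ a ∈ A', a ∈ graphBall G t R₀') → (bondPercolation G q).real (Skel.excess G t R₁ D' A') ≤ Neg.η κ Φ :=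
    fun R₀' R₁ hR Rw D' A' hD hbox hA hA' =>
      hRex_UA κ Φ t p O.merged g f ex mx q hCq (oL κ Φ t p O.D O.DT O.ori g f) le_rfl t R₀' R₁ hR Rw D' A' hD
        (fun d hd d' hd' => fine_diam_le_mRA κ Φ t p O.merged g f (mx κ Φ t p O.merged g f) hNL (hbox d hd d' hd')) hA hA'
  have hsch := hsch_UA κ Φ t p O.merged g f ex mx q
  -- ### assemble
  exact Skelφ.reachOblRHN_negSG₂b_of_floorsK hkq hfr hκc Φ.degree_le hstep hlip hAf hnL hm hc0' hc1' hDf hκL _ hfine hlipF hwsF hF0 (fcellsA κ Φ t p O.merged g f) hr40 _ _ _ _ _ q κ.δ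
    (b0TA κ Φ t p O.merged g f) (b0TA_le κ Φ t p O.merged g f) hΛ hgap hgapc hoff hE₀ hgapL hcol (fun _ y => colVA κ Φ t p O.merged g f hlip hstep hNL y) hcF hcQ hcD
    hgapc hvn hlay (KS.RA' κ Φ t p O.merged mk) ha hBx hb' hΔlo hΔhi hsc0 hsc1 P1 P2 P3 P4 P5 hbr hE₀Z (nmax := 926 * Neg.Kq κ) (by omega) hRl hj hcount hη hRex hsch
    Pk (le_trans (by norm_num) hPN) rfl hd1 hD1 hD2 hDρ hℓk hWk hKmax hKCmax hR'k hT hT' hr₀ hrs hcS hj₀T hjreach hRlreach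
    (fun c => RgO G (φL κ Φ t p O.D O.DT O.ori g f) (KS.QKO κ Φ t p O.D O.DT O.ori g f mk) c) hRg hRgcard hcU1 O.merged.Λ hkn hΛz hZc hMz hclear
    (fun i σ₀ c => pexXO G (φL κ Φ t p O.D O.DT O.ori g f) (KS.QKO κ Φ t p O.D O.DT O.ori g f mk) (Mu O.merged) (nL κ Φ t p O.merged g f) (hL κ Φ t p O.merged g f) Pk.A 1 i σ₀ c) hPex (KS.kkA κ Φ t p O.merged mk) hkN hk hδ0 hr₀L hLE hzone hexit hlongT hlongS

/-! ## §2 At the box / width / pair slots of record `(gT, fT, PR)`: only the two `ex` floors remain -/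

/-- **THE (C) RESIDUE OF THE CHOICES OF RECORD AT `(O, q)` FOR THE SLOTS OF RECORD** `gv := KS.gT mk gx`, `fv := KS.fT mk fx`, `Pv := KS.PR mk Px`,
`Sv := SU ex mx`: modulo the two floors on `ex`. [cite: KozmaNitzan2024, §4 Lemmas 10–12 (pp. 17–25)] -/
theorem reachOblRHN_negBTA_at {mk : ℕ} {gx fx : Neg.FSlot} {Px : PSlot}
    (hAt : (choiceAtOTA κ Φ t p (KS.gT mk gx) (KS.fT mk fx) (SUA ex mx) hC (KS.PR mk Px)).AtQO O q) (h1 : Φ.types = {t}) (hp0 : 0 < (p : ℝ)) (hp1 : (p : ℝ) < 1)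
    (hex₁ : KS.r₀A Φ t O.merged mk (O.merged.R (O.merged.scale t (ML κ Φ t p O.merged (KS.gT mk gx κ Φ t p O.merged))
        (nL κ Φ t p O.merged (KS.gT mk gx κ Φ t p O.merged) (KS.fT mk fx κ Φ t p O.merged)))) + 3 ≤
      ex κ Φ t p O.merged (KS.gT mk gx κ Φ t p O.merged) (KS.fT mk fx κ Φ t p O.merged))
    (hex₂ : 4 + 13 * (20 * Neg.K κ * (nL κ Φ t p O.merged (KS.gT mk gx κ Φ t p O.merged) (KS.fT mk fx κ Φ t p O.merged) +
        Skelφ.CorrRec.Qw (nL κ Φ t p O.merged (KS.gT mk gx κ Φ t p O.merged) (KS.fT mk fx κ Φ t p O.merged))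
          (ℓL κ Φ t p O.merged (KS.gT mk gx κ Φ t p O.merged) (KS.fT mk fx κ Φ t p O.merged))
          (hL κ Φ t p O.merged (KS.gT mk gx κ Φ t p O.merged) (KS.fT mk fx κ Φ t p O.merged)))) ≤
      ex κ Φ t p O.merged (KS.gT mk gx κ Φ t p O.merged) (KS.fT mk fx κ Φ t p O.merged)) :
    Skel.ReachOblRHN G (926 * Neg.Kq κ) ((choiceAtOTA κ Φ t p (KS.gT mk gx) (KS.fT mk fx) (SUA ex mx) hC (KS.PR mk Px)).scheme O q)
      ((choiceAtOTA κ Φ t p (KS.gT mk gx) (KS.fT mk fx) (SUA ex mx) hC (KS.PR mk Px)).FD O q) Φ.Δ (κ.δr 0) := by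
  have hEqL := clauseL_of_atQOTA hAt
  have hNL : EqNumL κ Φ t p O.merged (KS.gT mk gx κ Φ t p O.merged) (KS.fT mk fx κ Φ t p O.merged) := eqNumL_of_atQOTA hAt
  have hκL : (hL κ Φ t p O.merged (KS.gT mk gx κ Φ t p O.merged) (KS.fT mk fx κ Φ t p O.merged)).natAbs ≤
      10 * nL κ Φ t p O.merged (KS.gT mk gx κ Φ t p O.merged) (KS.fT mk fx κ Φ t p O.merged) := hEqL.2
  obtain ⟨-, P2⟩ := KS.corridor_floors_T κ Φ t p O.merged mk gx fx hNL hκL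
  have hlayT := KS.layer_T κ Φ t p O.merged mk gx (KS.fT mk fx κ Φ t p O.merged) hNL hκL
  have hℓ := KS.ℓL_ge_T κ Φ t p O.merged mk gx (KS.fT mk fx κ Φ t p O.merged) hNL
  have hclr := KS.hclrz_T κ Φ t p O.merged mk gx (KS.fT mk fx κ Φ t p O.merged) hNL hκL
  have hU0 : (0 : ℤ) ≤ ((nL κ Φ t p O.merged (KS.gT mk gx κ Φ t p O.merged) (KS.fT mk fx κ Φ t p O.merged) +
      (hL κ Φ t p O.merged (KS.gT mk gx κ Φ t p O.merged) (KS.fT mk fx κ Φ t p O.merged)).natAbs : ℕ) : ℤ) := Nat.cast_nonneg _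
  have hR0 : (0 : ℤ) ≤ (KS.RA' κ Φ t p O.merged mk : ℤ) := Nat.cast_nonneg _
  have h24 : (24 : ℤ) ≤ ℓL κ Φ t p O.merged (KS.gT mk gx κ Φ t p O.merged) (KS.fT mk fx κ Φ t p O.merged) := by linarith
  have hclr' : (((Mu O.merged + 4) * (nL κ Φ t p O.merged (KS.gT mk gx κ Φ t p O.merged) (KS.fT mk fx κ Φ t p O.merged) +
        (hL κ Φ t p O.merged (KS.gT mk gx κ Φ t p O.merged) (KS.fT mk fx κ Φ t p O.merged)).natAbs) : ℕ) : ℤ) ≤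
      ((nL κ Φ t p O.merged (KS.gT mk gx κ Φ t p O.merged) (KS.fT mk fx κ Φ t p O.merged) *
        (ℓL κ Φ t p O.merged (KS.gT mk gx κ Φ t p O.merged) (KS.fT mk fx κ Φ t p O.merged) + 1) : ℕ) : ℤ) := by
    push_cast [Int.natCast_natAbs]; exact hclr
  exact reachOblRHN_negBTA_SU hAt h1 hp0 hp1 mk (KS.kit_mem_PR κ Φ t p O.merged mk Px) (g := KS.gT mk gx κ Φ t p O.merged)
    (f := KS.fT mk fx κ Φ t p O.merged) rfl rfl
    (KS.nL_floorsT κ Φ t p O.merged mk fx (KS.gT mk gx κ Φ t p O.merged)).2.1 P2 (by nlinarith [hlayT, hU0, hR0]) (by exact_mod_cast h24)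
    (by exact_mod_cast hclr') hex₁ hex₂

end AtQ

end NegB

/-! ## §3 `ReachHoldsRHNOFnL NegB.LfA` of the (ζ′) choice function — general, at `ex := exA`, and at the slot-ledger v1 values -/

/-- **`ReachHoldsRHNOFnL NegB.LfA (negChoiceAllOTA (KS.gT mk gx) (KS.fT mk fx) (KS.PR mk Px) (NegB.SUA ex mx))`** — the (C) hypothesis of
`samePDropOfSkeletonNeg₁_of_choiceFnNOWL` for the (ζ′) choice function, for every kit index `mk` and all residual slot functions `gx fx Px mx`, as soon
as the residual depth slot `ex` clears the two corridor floors at every record: `r₀A(R_l) + 3 ≤ ex` and `4 + 13·(20K·(n_L + W_B)) ≤ ex`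
(`W_B = CorrRec.Qw n_L ℓ_L h_L`). [cite: KozmaNitzan2024, §4 Theorem 6 (pp. 25–31), Lemmas 10–12] -/
theorem reachHoldsRHNOFnL_negChoiceAllOTA (mk : ℕ) (gx fx : Neg.FSlot) (Px : NegB.PSlot) (ex mx : NegB.GSlot)
    (hex : ∀ (κ : Consts) {V : Type} [DecidableEq V] [Countable V] {G : SimpleGraph V} [G.LocallyFinite] (Φ : PlanarSkeletonNeg G) (t : V) (p : unitInterval)
      (D : DataN V),
      NegB.KS.r₀A Φ t D mk (D.R (D.scale t (NegB.ML κ Φ t p D (NegB.KS.gT mk gx κ Φ t p D))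
          (NegB.nL κ Φ t p D (NegB.KS.gT mk gx κ Φ t p D) (NegB.KS.fT mk fx κ Φ t p D)))) + 3 ≤
        ex κ Φ t p D (NegB.KS.gT mk gx κ Φ t p D) (NegB.KS.fT mk fx κ Φ t p D) ∧
      4 + 13 * (20 * Neg.K κ * (NegB.nL κ Φ t p D (NegB.KS.gT mk gx κ Φ t p D) (NegB.KS.fT mk fx κ Φ t p D) +
          Skelφ.CorrRec.Qw (NegB.nL κ Φ t p D (NegB.KS.gT mk gx κ Φ t p D) (NegB.KS.fT mk fx κ Φ t p D))
            (NegB.ℓL κ Φ t p D (NegB.KS.gT mk gx κ Φ t p D) (NegB.KS.fT mk fx κ Φ t p D))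
            (NegB.hL κ Φ t p D (NegB.KS.gT mk gx κ Φ t p D) (NegB.KS.fT mk fx κ Φ t p D)))) ≤
        ex κ Φ t p D (NegB.KS.gT mk gx κ Φ t p D) (NegB.KS.fT mk fx κ Φ t p D)) :
    ReachHoldsRHNOFnL NegB.LfA (negChoiceAllOTA (NegB.KS.gT mk gx) (NegB.KS.fT mk fx) (NegB.KS.PR mk Px) (NegB.SUA ex mx)) := by
  refine reachHoldsRHNOFnL_negChoiceAllOTA_of _ _ _ _ ?_
  intro κ V _ _ _ _ Φ t p _ O _ hAt h1 hp0 hp1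
  exact NegB.reachOblRHN_negBTA_at hAt h1 hp0 hp1 (hex κ Φ t p O.merged).1 (hex κ Φ t p O.merged).2

/-- **THE (C) HYPOTHESIS OF THE NODE AT `ex := exA`, UNCONDITIONAL** (kit index `0`, any box/width residuals `gx fx`, any extra pairs `Px`, any
excess-diameter residual `mx`): `ReachHoldsRHNOFnL NegB.LfA (negChoiceAllOTA (KS.gT 0 gx) (KS.fT 0 fx) (KS.PR 0 Px) (NegB.SUA NegB.exA mx))` — the two
`ex`-floors hold at stmt-g16's `NegB.exA` (`NegB.hex_exA`). [cite: KozmaNitzan2024, §4 Theorem 6 (pp. 25–31), Lemmas 10–12] -/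
theorem reachHoldsRHNOFnL_negChoiceAllOTA_exA (gx fx : Neg.FSlot) (Px : NegB.PSlot) (mx : NegB.GSlot) :
    ReachHoldsRHNOFnL NegB.LfA (negChoiceAllOTA (NegB.KS.gT 0 gx) (NegB.KS.fT 0 fx) (NegB.KS.PR 0 Px) (NegB.SUA NegB.exA mx)) :=
  reachHoldsRHNOFnL_negChoiceAllOTA 0 gx fx Px NegB.exA mx (NegB.hex_exA gx fx)

/-- **THE (C) HYPOTHESIS OF THE NODE AT THE SLOT-LEDGER (ζ′) v1 VALUES** `gv := KS.gT 0 (KS.gxA c)`, `fv := KS.fT 0 KS.fxA`, `Sv := SUA exA mx` (the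
face-kit index `c`, the extra pairs `Px` and the excess-diameter residual `mx` stay binders). [cite: KozmaNitzan2024, §4 Theorem 6 (pp. 25–31)] -/
theorem reachHoldsRHNOFnL_negChoiceAllOTA_R (c : ℕ) (Px : NegB.PSlot) (mx : NegB.GSlot) :
    ReachHoldsRHNOFnL NegB.LfA (negChoiceAllOTA (NegB.KS.gT 0 (NegB.KS.gxA c)) (NegB.KS.fT 0 NegB.KS.fxA) (NegB.KS.PR 0 Px) (NegB.SUA NegB.exA mx)) :=
  reachHoldsRHNOFnL_negChoiceAllOTA_exA (NegB.KS.gxA c) NegB.KS.fxA Px mx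

end PlanarSkeletonNeg

end Summit.CriticalPhenomena.PercolationContinuityZ3.Theorems.Transplant

end
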